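import Mathlib
import Summits.Ventures.PercRepro2.ThreeTermPartLaw

/-!
# Three-terminal parts, IV a: the antipodal Harris inequality
(blind cell PercRepro2, night-3 g30, 2026-08-29; `proofs/NIGHT3-CERT.md` §39)

The typed Harris condition `TypedHarris πpat (partLaw S τ pat)` of `typedCount_part_nonneg`
(ThreeTermPartLaw.lean) compares, for each generator `s = (U_S, U_S′)` and each copy-1 pattern `a`, the
number of typed triples with copy 2 in `U_S ∩ U_S′` against the number with copy 2 in `U_S` and copy 3 in
`U_S′`.  This file proves the inequality behind it with the cell's own Harris toolbox, for ARBITRARY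
upper sets in place of the up-set events:

* `hh s p q = [p ∈ U_S]·([p ∈ U_S′] − [q ∈ U_S′])` — the unsymmetrised slack, whose symmetrisation is
  the bilinear coefficient `hq s p q` of TypedStarWorld.lean (`hq_eq_hh`; `U_S ∩ U_S′ = U_{S∩S′}`);
* CONDITIONING ON COPY 1: given a copy-1 configuration `x`, the typed pairs `(y, z)` with open counts
  `τ` are exactly the points `y` of a SUB-CUBE (`InCube`: `y` open on the edges with `τ e = x e + 2`,
  closed where `τ e = x e`, free on the SPLIT edges `τ e = x e + 1`) together with `z = ant x y`, the
  ANTIPODE of `y` on the split edges (`typed_iff`, `sum_typed`);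
* the uniform measure on the cube is the product measure `px` (`½` on the split edges, `1` / `0`
  elsewhere) — its weight is `(½)^{|Sp|}` on the cube and `0` off it (`weight_px`, `prob_px`); the
  antipode is an antitone involution of the cube, so the preimage of an upper set is a lower set
  (`isLowerSet_ant`) of the same mass (`sum_ant`);
* **`antipodal_harris`**: for upper sets `P`, `Q`, `#{y ∈ cube : P y ∧ Q (ant y)} ≤ #{y ∈ cube : P y ∧ Q y}`
  — the mixed Harris inequality `P(A ∩ B) ≤ P(A) P(B)` for a lower and an upper set
  (`prob_inter_le_prob_mul_prob_of_isLowerSet`) followed by Harris `P(A) P(B) ≤ P(A ∩ B)`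
  (`prob_mul_prob_le_prob_inter`).

ThreeTermPartHarris.lean applies it to the up-set events of the pattern and derives the typed Harris
condition for EVERY typed three-terminal part.  Own work; standard axioms.
-/

namespace Summit.Ventures.PercRepro2

open Block ThreeTerm TypedStar

namespace Part

/-! ## The up-sets of the partition lattice and the unsymmetrised slack -/

section Slack

/-- The left up-set `U_S` of generator `s` (`0 = ⊥`, `1 = 01`, `2 = 02`, `3 = 12`, `4 = ⊤`):
`(U_1,U_2)`, `(U_1,U_3)`, `(U_2,U_3)`, `(U_1,U_23)`, `(U_2,U_13)`, `(U_3,U_12)`, `(U_12,U_13)`,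
`(U_12,U_23)`, `(U_13,U_23)`. -/
def uL (s : Fin 9) (p : Fin 5) : Bool :=
  match s with
  | 0 => p = 1 || p = 4
  | 1 => p = 1 || p = 4
  | 2 => p = 2 || p = 4
  | 3 => p = 1 || p = 4
  | 4 => p = 2 || p = 4
  | 5 => p = 3 || p = 4
  | 6 => p = 1 || p = 2 || p = 4
  | 7 => p = 1 || p = 2 || p = 4
  | 8 => p = 1 || p = 3 || p = 4

/-- The right up-set `U_S′` of generator `s`. -/
def uR (s : Fin 9) (p : Fin 5) : Bool :=
  match s with
  | 0 => p = 2 || p = 4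
  | 1 => p = 3 || p = 4
  | 2 => p = 3 || p = 4
  | 3 => p = 2 || p = 3 || p = 4
  | 4 => p = 1 || p = 3 || p = 4
  | 5 => p = 1 || p = 2 || p = 4
  | 6 => p = 1 || p = 3 || p = 4
  | 7 => p = 2 || p = 3 || p = 4
  | 8 => p = 2 || p = 3 || p = 4

/-- The unsymmetrised bilinear form of the slack `s`:
`[p ∈ U_S]·([p ∈ U_S′] − [q ∈ U_S′])` (`= [p ∈ U_{S∩S′}] − [p ∈ U_S][q ∈ U_S′]`). -/
def hh (s : Fin 9) (p q : Fin 5) : ℚ :=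
  (if uL s p then 1 else 0) * ((if uR s p then 1 else 0) - (if uR s q then 1 else 0))

/-- The symmetrised slack coefficients are the average of `hh` and its transpose. -/
lemma hq_eq_hh (s : Fin 9) (p q : Fin 5) : hq s p q = (hh s p q + hh s q p) / 2 := by
  fin_cases s <;> fin_cases p <;> fin_cases q <;> simp [hq, sym, hh, uL, uR] <;> norm_num

end Slack

/-! ## Conditioning on copy 1: the sub-cube, the antipode and the uniform weights -/

section Cube

variable {E : Type*} [Fintype E] [DecidableEq E] (S : Finset E) (τ : E → ℕ) (x : Config E)

/-- The SPLIT edges given copy 1: exactly one of copies 2, 3 is open there (`τ e = x e + 1`). -/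
def splitSet : Finset E := S.filter fun e => τ e = (x e).toNat + 1

/-- The required value of copy 2 (and 3) off the split edges: open iff `e ∈ S` and `τ e = x e + 2`. -/
def req (e : E) : Bool := decide (e ∈ S ∧ τ e = (x e).toNat + 2)

/-- The sub-cube of copy 2 given copy 1: `y` takes the required value off the split edges. -/
abbrev InCube (y : Config E) : Prop := ∀ e, e ∉ splitSet S τ x → y e = req S τ x e

/-- The antipode of copy 2 given copy 1: flipped on the split edges, the required value elsewhere. -/
def ant (y : Config E) : Config E := fun e => if e ∈ splitSet S τ x then !(y e) else req S τ x e

/-- Admissibility of copy 1: every typed count is `x e`, `x e + 1` or `x e + 2`. -/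
def Adm : Prop := ∀ e ∈ S, τ e = (x e).toNat ∨ τ e = (x e).toNat + 1 ∨ τ e = (x e).toNat + 2

/-- The product weights of the uniform measure on the cube: `½` on the split edges, `1` / `0` elsewhere. -/
def px : E → ℚ := fun e => if e ∈ splitSet S τ x then 1 / 2 else if req S τ x e then 1 else 0

omit [Fintype E] [DecidableEq E] in
/-- Membership in the split set. -/
lemma mem_splitSet {e : E} : e ∈ splitSet S τ x ↔ e ∈ S ∧ τ e = (x e).toNat + 1 := by
  simp [splitSet]

omit [Fintype E] in
/-- The required value is `true` iff `e ∈ S` and `τ e = x e + 2`. -/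
lemma req_eq_true {e : E} : req S τ x e = true ↔ e ∈ S ∧ τ e = (x e).toNat + 2 := by
  simp [req]

omit [Fintype E] [DecidableEq E] in
/-- `toNat` of a Boolean is at most `1`. -/
lemma toNat_le_one (b : Bool) : b.toNat ≤ 1 := by cases b <;> simp

omit [Fintype E] in
/-- **Typed pairs given copy 1 are the cube with the antipode.** -/
lemma typed_iff (hx : SuppOn S x) (hadm : Adm S τ x) (y z : Config E) :
    ((SuppOn S x ∧ SuppOn S y ∧ SuppOn S z) ∧ ∀ e ∈ S, openCount x y z e = τ e) ↔
      (InCube S τ x y ∧ z = ant S τ x y) := by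
  constructor
  · rintro ⟨⟨-, hy, hz⟩, hc⟩
    have key : ∀ e, (e ∈ splitSet S τ x → z e = !(y e)) ∧
        (e ∉ splitSet S τ x → y e = req S τ x e ∧ z e = req S τ x e) := by
      intro e
      by_cases heS : e ∈ S
      · have hce := hc e heS
        simp only [openCount] at hce
        rcases hadm e heS with h | h | h
        · have h1 : e ∉ splitSet S τ x := fun hm => by
            have := (mem_splitSet S τ x).1 hm; omega
          have hr : req S τ x e = false := by
            simp only [req, decide_eq_false_iff_not, not_and]; intro; omega
          refine ⟨fun hm => absurd hm h1, fun _ => ?_⟩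
          rw [hr]
          cases hy' : y e <;> cases hz' : z e <;>
            simp only [hy', hz', Bool.toNat_false, Bool.toNat_true] at hce <;>
            first | exact ⟨rfl, rfl⟩ | (exfalso; omega)
        · have h1 : e ∈ splitSet S τ x := (mem_splitSet S τ x).2 ⟨heS, h⟩
          refine ⟨fun _ => ?_, fun hm => absurd h1 hm⟩
          cases hy' : y e <;> cases hz' : z e <;>
            simp only [hy', hz', Bool.toNat_false, Bool.toNat_true] at hce <;>
            first | rfl | (exfalso; omega)
        · have h1 : e ∉ splitSet S τ x := fun hm => by
            have := (mem_splitSet S τ x).1 hm; omega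
          have hr : req S τ x e = true := (req_eq_true S τ x).2 ⟨heS, h⟩
          refine ⟨fun hm => absurd hm h1, fun _ => ?_⟩
          rw [hr]
          cases hy' : y e <;> cases hz' : z e <;>
            simp only [hy', hz', Bool.toNat_false, Bool.toNat_true] at hce <;>
            first | exact ⟨rfl, rfl⟩ | (exfalso; omega)
      · have h1 : e ∉ splitSet S τ x := fun hm => heS ((mem_splitSet S τ x).1 hm).1
        have hr : req S τ x e = false := by
          simp only [req, decide_eq_false_iff_not, not_and]; intro h; exact absurd h heS
        refine ⟨fun hm => absurd hm h1, fun _ => ?_⟩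
        rw [hr]
        have hy' : y e = false := by
          by_contra h; exact heS (hy e (by simpa using h))
        have hz' : z e = false := by
          by_contra h; exact heS (hz e (by simpa using h))
        exact ⟨hy', hz'⟩
    refine ⟨fun e he => ((key e).2 he).1, ?_⟩
    funext e
    by_cases he : e ∈ splitSet S τ x
    · simp only [ant, he, if_true]; exact (key e).1 he
    · simp only [ant, he, if_false]; exact ((key e).2 he).2
  · rintro ⟨hcube, rfl⟩
    have hySupp : SuppOn S y := by
      intro e he
      by_cases hm : e ∈ splitSet S τ x
      · exact ((mem_splitSet S τ x).1 hm).1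
      · have := hcube e hm
        rw [he] at this
        exact ((req_eq_true S τ x).1 this.symm).1
    have hzSupp : SuppOn S (ant S τ x y) := by
      intro e he
      by_cases hm : e ∈ splitSet S τ x
      · exact ((mem_splitSet S τ x).1 hm).1
      · simp only [ant, hm, if_false] at he
        exact ((req_eq_true S τ x).1 he).1
    refine ⟨⟨hx, hySupp, hzSupp⟩, fun e heS => ?_⟩
    simp only [openCount]
    rcases hadm e heS with h | h | h
    · have h1 : e ∉ splitSet S τ x := fun hm => by
        have := (mem_splitSet S τ x).1 hm; omega
      have hr : req S τ x e = false := by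
        simp only [req, decide_eq_false_iff_not, not_and]; intro; omega
      have hy := hcube e h1
      simp only [ant, h1, if_false]
      rw [hy, hr]; simp; omega
    · have h1 : e ∈ splitSet S τ x := (mem_splitSet S τ x).2 ⟨heS, h⟩
      simp only [ant, h1, if_true]
      cases y e <;> simp <;> omega
    · have h1 : e ∉ splitSet S τ x := fun hm => by
        have := (mem_splitSet S τ x).1 hm; omega
      have hr : req S τ x e = true := (req_eq_true S τ x).2 ⟨heS, h⟩
      have hy := hcube e h1
      simp only [ant, h1, if_false]
      rw [hy, hr]; simp; omega

omit [Fintype E] [DecidableEq E] in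
/-- No typed pair exists when copy 1 is not supported on `S` or not admissible. -/
lemma not_typed (h : ¬ (SuppOn S x ∧ Adm S τ x)) (y z : Config E) :
    ¬ ((SuppOn S x ∧ SuppOn S y ∧ SuppOn S z) ∧ ∀ e ∈ S, openCount x y z e = τ e) := by
  rintro ⟨⟨hx, -, -⟩, hc⟩
  refine h ⟨hx, fun e he => ?_⟩
  have := hc e he
  simp only [openCount] at this
  have := toNat_le_one (y e); have := toNat_le_one (z e)
  omega

/-- **The typed sum given copy 1 is the sum over the cube with the antipode.** -/
lemma sum_typed (hx : SuppOn S x) (hadm : Adm S τ x) (g : Config E → Config E → ℚ) :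
    (∑ y : Config E, ∑ z : Config E,
      if (SuppOn S x ∧ SuppOn S y ∧ SuppOn S z) ∧ ∀ e ∈ S, openCount x y z e = τ e then g y z else 0) =
      ∑ y : Config E, if InCube S τ x y then g y (ant S τ x y) else 0 := by
  refine Finset.sum_congr rfl fun y _ => ?_
  by_cases hy : InCube S τ x y
  · rw [if_pos hy]
    rw [Finset.sum_eq_single (ant S τ x y)]
    · rw [if_pos ((typed_iff S τ x hx hadm y _).2 ⟨hy, rfl⟩)]
    · intro z _ hz
      rw [if_neg]
      intro h
      exact hz ((typed_iff S τ x hx hadm y z).1 h).2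
    · intro h; exact absurd (Finset.mem_univ _) h
  · rw [if_neg hy]
    refine Finset.sum_eq_zero fun z _ => ?_
    rw [if_neg]
    intro h
    exact hy ((typed_iff S τ x hx hadm y z).1 h).1

omit [Fintype E] in
/-- The antipode is antitone. -/
lemma ant_antitone {y y' : Config E} (h : y ≤ y') : ant S τ x y' ≤ ant S τ x y := by
  intro e
  have h1 := h e
  simp only [ant]
  split_ifs
  · cases hy : y e <;> cases hy' : y' e <;> simp_all [Bool.le_iff_imp]
  · exact le_rfl

omit [Fintype E] in
/-- The antipode of a cube point is a cube point. -/
lemma inCube_ant {y : Config E} (_ : InCube S τ x y) : InCube S τ x (ant S τ x y) := by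
  intro e he
  simp [ant, he]

omit [Fintype E] in
/-- The antipode is an involution on the cube. -/
lemma ant_ant {y : Config E} (hy : InCube S τ x y) : ant S τ x (ant S τ x y) = y := by
  funext e
  by_cases he : e ∈ splitSet S τ x
  · simp [ant, he]
  · simp [ant, he, hy e he]

omit [Fintype E] in
/-- The preimage of an upper set under the antipode is a lower set. -/
lemma isLowerSet_ant (Q : Config E → Prop) (hQ : IsUpperSet {y | Q y}) :
    IsLowerSet {y | Q (ant S τ x y)} := by
  intro y y' hle hy
  exact hQ (ant_antitone S τ x hle) hy

omit [Fintype E] in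
/-- The uniform weights are admissible. -/
lemma isProbVec_px : IsProbVec (px S τ x) := by
  refine ⟨fun e => ?_, fun e => ?_⟩ <;> simp only [px] <;> split_ifs <;> norm_num

/-- **The weight of the uniform measure**: `(½)^{|Sp|}` on the cube, `0` off it. -/
lemma weight_px (y : Config E) :
    weight (px S τ x) y = (1 / 2 : ℚ) ^ (splitSet S τ x).card * (if InCube S τ x y then 1 else 0) := by
  unfold weight
  rw [← Finset.prod_mul_prod_compl (splitSet S τ x)]
  have h1 : (∏ e ∈ splitSet S τ x, edgeFactor (px S τ x e) (y e)) = (1 / 2 : ℚ) ^ (splitSet S τ x).card := by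
    rw [← Finset.prod_const]
    refine Finset.prod_congr rfl fun e he => ?_
    simp only [px, he, if_true, edgeFactor]
    split_ifs <;> norm_num
  have h2 : (∏ e ∈ (splitSet S τ x)ᶜ, edgeFactor (px S τ x e) (y e)) =
      if InCube S τ x y then 1 else 0 := by
    have step : ∀ e ∈ (splitSet S τ x)ᶜ, edgeFactor (px S τ x e) (y e) =
        if y e = req S τ x e then 1 else 0 := by
      intro e he
      rw [Finset.mem_compl] at he
      simp only [px, he, if_false, edgeFactor]
      cases y e <;> cases req S τ x e <;> simp
    rw [Finset.prod_congr rfl step, Finset.prod_boole]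
    simp only [Finset.mem_compl]
  rw [h1, h2]

/-- **The probability of an event under the uniform measure** is the normalised count on the cube. -/
lemma prob_px (P : Config E → Prop) [DecidablePred P] :
    prob (px S τ x) {y | P y} =
      (1 / 2 : ℚ) ^ (splitSet S τ x).card * ∑ y : Config E, if InCube S τ x y ∧ P y then 1 else 0 := by
  unfold prob
  rw [Finset.mul_sum]
  refine Finset.sum_congr rfl fun y _ => ?_
  rw [Set.indicator_apply, weight_px]
  simp only [Set.mem_setOf_eq]
  split_ifs <;> simp_all

/-- **The antipode preserves the count**: an event and its antipodal image have the same mass. -/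
lemma sum_ant (Q : Config E → Prop) [DecidablePred Q] :
    (∑ y : Config E, if InCube S τ x y ∧ Q (ant S τ x y) then (1 : ℚ) else 0) =
      ∑ y : Config E, if InCube S τ x y ∧ Q y then 1 else 0 := by
  rw [← Finset.sum_filter_add_sum_filter_not Finset.univ (InCube S τ x),
    ← Finset.sum_filter_add_sum_filter_not Finset.univ (InCube S τ x)]
  have hz : ∀ (R : Config E → Prop) [DecidablePred R],
      (∑ y ∈ Finset.univ.filter (fun y => ¬ InCube S τ x y),
        if InCube S τ x y ∧ R y then (1 : ℚ) else 0) = 0 := by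
    intro R _
    refine Finset.sum_eq_zero fun y hy => ?_
    rw [Finset.mem_filter] at hy
    simp [hy.2]
  rw [hz, hz, add_zero, add_zero]
  refine Finset.sum_nbij' (ant S τ x) (ant S τ x) ?_ ?_ ?_ ?_ ?_
  · intro y hy
    rw [Finset.mem_filter] at hy ⊢
    exact ⟨Finset.mem_univ _, inCube_ant S τ x hy.2⟩
  · intro y hy
    rw [Finset.mem_filter] at hy ⊢
    exact ⟨Finset.mem_univ _, inCube_ant S τ x hy.2⟩
  · intro y hy
    have hy' : InCube S τ x y := by simpa using hy
    exact ant_ant S τ x hy'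
  · intro y hy
    have hy' : InCube S τ x y := by simpa using hy
    exact ant_ant S τ x hy'
  · intro y hy
    have hy' : InCube S τ x y := by simpa using hy
    have := inCube_ant S τ x hy'
    by_cases hq : Q (ant S τ x y)
    · rw [if_pos ⟨hy', hq⟩, if_pos ⟨this, hq⟩]
    · rw [if_neg (fun h => hq h.2), if_neg (fun h => hq h.2)]

/-- **THE ANTIPODAL HARRIS INEQUALITY**: for upper sets `P`, `Q`, the cube points with `y ∈ P` and
`ant y ∈ Q` are no more numerous than those with `y ∈ P` and `y ∈ Q` (mixed Harris, then Harris). -/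
theorem antipodal_harris (P Q : Config E → Prop) [DecidablePred P] [DecidablePred Q]
    (hP : IsUpperSet {y | P y}) (hQ : IsUpperSet {y | Q y}) :
    (∑ y : Config E, if InCube S τ x y ∧ P y ∧ Q (ant S τ x y) then (1 : ℚ) else 0) ≤
      ∑ y : Config E, if InCube S τ x y ∧ P y ∧ Q y then 1 else 0 := by
  have hp := isProbVec_px S τ x
  set c : ℚ := (1 / 2 : ℚ) ^ (splitSet S τ x).card with hc
  have hcpos : 0 < c := by positivity
  -- mixed Harris: the antipodal event is a lower set
  have h1 := prob_inter_le_prob_mul_prob_of_isLowerSet hp (isLowerSet_ant S τ x Q hQ) hP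
  -- Harris
  have h2 := prob_mul_prob_le_prob_inter hp hP hQ
  have e1 : ({y | Q (ant S τ x y)} ∩ {y | P y} : Set (Config E)) = {y | P y ∧ Q (ant S τ x y)} := by
    ext y; simp [and_comm]
  have e2 : ({y | P y} ∩ {y | Q y} : Set (Config E)) = {y | P y ∧ Q y} := by
    ext y; simp
  rw [e1] at h1
  rw [e2] at h2
  rw [prob_px, prob_px, prob_px] at h1
  rw [prob_px, prob_px, prob_px] at h2
  rw [sum_ant] at h1
  have key : c * (∑ y : Config E, if InCube S τ x y ∧ (P y ∧ Q (ant S τ x y)) then (1 : ℚ) else 0) ≤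
      c * ∑ y : Config E, if InCube S τ x y ∧ (P y ∧ Q y) then 1 else 0 := by
    calc c * (∑ y : Config E, if InCube S τ x y ∧ (P y ∧ Q (ant S τ x y)) then (1 : ℚ) else 0)
        ≤ (c * ∑ y : Config E, if InCube S τ x y ∧ Q y then (1 : ℚ) else 0) *
          (c * ∑ y : Config E, if InCube S τ x y ∧ P y then (1 : ℚ) else 0) := h1
      _ = (c * ∑ y : Config E, if InCube S τ x y ∧ P y then (1 : ℚ) else 0) *
          (c * ∑ y : Config E, if InCube S τ x y ∧ Q y then (1 : ℚ) else 0) := by ring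
      _ ≤ c * ∑ y : Config E, if InCube S τ x y ∧ (P y ∧ Q y) then 1 else 0 := h2
  exact le_of_mul_le_mul_left key hcpos

end Cube

end Part

end Summit.Ventures.PercRepro2
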